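import Literature.NumberTheory.GaloisRepresentations.PotentialDiagonalizabilityFontaineLaffaille
import HarnessLib

/-!
# Potential diagonalizability for Hodge–Tate weights in an interval of length `p − 1`
# (Gao–Liu 2014, Main Theorem 3.0.3)

Companion of `PotentialDiagonalizabilityFontaineLaffaille.lean`, which vendors Barnet-Lamb–Gee–
Geraghty–Taylor's Lemma 1.4.3 (2) (`blggt2014_lemma_1_4_3_2`: `K/ℚ_p` unramified, `ρ` crystalline,
`HT_τ(ρ) ⊂ [a_τ, a_τ + p − 2]` for every label ⟹ `ρ` potentially diagonalizable).  Gao–Liu extend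
the range by one:

* **Source (held, read: arXiv:1204.4704 = Math. Ann. 360 (2014) 481–487).**  Abstract: "Let
  `K₀/ℚ_p` be a finite unramified extension … We show that all crystalline representations of
  `G_{K₀}` with Hodge–Tate weights `⊆ {0, ⋯, p−1}` are potentially diagonalizable."  §3,
  **Theorem 3.0.3 (Main Theorem).** "Suppose `ρ : G_{K₀} → GL_d(ℚ̄_p)` is a crystalline
  representation, and for each `τ : K₀ ↪ ℚ̄_p`, the Hodge–Tate numbers
  `HT_τ(ρ) ⊆ {a_τ, …, a_τ + p − 1}`, then `ρ` is potentially diagonalizable."  (Any prime `p`, any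
  `d`; no hypothesis on `ρ̄`.  Proof: reduce to `ρ` irreducible, hence "nilpotent"; Fontaine–Laffaille
  theory extends to nilpotent objects of `MF^{[0,p−1]}`; lift `ρ̄|_{G_{K'}}` with its flag as in BLGGT
  Lemma 1.4.2, connect inside `Spec R^{n}_{ρ̄,cris} ⊂ Spec R^□_{ρ̄,{HT_τ},K-cris}[1/p]`, and apply
  Lemma 1.4.3 (1).)  "Potentially diagonalizable" and `∼` are BLGGT's (§2.1 of the note recalls
  them verbatim, with Lemma 1.4.1).
* **Sign convention.**  Gao–Liu normalise `HT_τ(ε) = {1}` ("slightly different from that in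
  [BLGGT10]"); the tree follows BLGGT (`HT_τ(ε) = {−1}`, `PeriodRingData.labelledHodgeTateWeights`).
  The hypothesis "contained in SOME interval of length `p − 1`" is invariant under `h ↦ −h`, so the
  rendering below is faithful in either convention.

## Rendering (identical to the accepted `blggt2014_lemma_1_4_3_2`, with `p − 2 ↦ p − 1`)

* `K/ℚ_p` finite (`[FiniteDimensional ℚ_[p] K]`) and unramified (`IsAbsolutelyUnramified p K`:
  `K = ℚ_p(ζ)`, `ζ` of order prime to `p`);
* "`ρ` crystalline": `IsCrystallineFn (𝔅 ⊥) (ρ|_{Γ_⊥}).matrixFn` relative to crystalline extension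
  data `𝔅 : CrystallineExtensionData p K` (base field `⊥ ≃ K`), as in `IsDiagonalizable`;
* labels `τ : F₀ →+* ℚ̄_p` of the invariant field `F₀` of `𝔅 ⊥` (for the intended `B_cris(K)`,
  `F₀ = K₀ = K`), weights `PeriodRingData.labelledHodgeTateWeights` of the `ℚ̄_p`-linear `ρ|_{Γ_⊥}`;
* the range hypothesis as the `m`-parametrised predicate `HasLabelledHodgeTateWeightsInRange 𝔅 ρ m`
  ("`HT_τ(ρ) ⊂ [a_τ, a_τ + m]` for every `τ`"), of which the accepted
  `HasLabelledHodgeTateWeightsInFLRange` is the case `m = p − 2` (`Iff.rfl`,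
  `hasLabelledHodgeTateWeightsInFLRange_iff_inRange`) and Gao–Liu's hypothesis the case
  `m = p − 1`.

## Main statements

* `HasLabelledHodgeTateWeightsInRange 𝔅 ρ m` (definition) with `_iff`, `.mono`,
  `hasLabelledHodgeTateWeightsInFLRange_iff_inRange`.
* `gaoLiu2014_mainTheorem` — NAMED FACT (D-0014), Theorem 3.0.3.
* `gaoLiu2014_mainTheorem.blggt2014_lemma_1_4_3_2` — PROVED: the new fact implies the accepted
  `blggt2014_lemma_1_4_3_2` (an interval of length `p − 2` has length `≤ p − 1`), as Gao–Liu's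
  introduction says.

## References

* H. Gao, T. Liu, *A note on potential diagonalizability of crystalline representations*,
  Math. Ann. 360 (2014) 481–487, Thm. 3.0.3 (arXiv:1204.4704, §3). [GaoLiu2014]
* T. Barnet-Lamb, T. Gee, D. Geraghty, R. Taylor, *Potential automorphy and change of weight*,
  Ann. of Math. 179 (2014), §1.4, Lemma 1.4.1, Lemma 1.4.3 (arXiv:1010.2561 pp. 14–15).
  [BarnetlambEtAl2014]
-/

noncomputable section

open Field

namespace Literature.NumberTheory.GaloisRepresentations

universe u w

/-! ### Weights in an interval of prescribed length -/

section Range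

variable {p : ℕ} [Fact p.Prime] {K : Type u} [Field K] [Algebra ℚ_[p] K] {n : ℕ}

/-- **`HT_τ(ρ) ⊂ [a_τ, a_τ + m]` for every label `τ`**: for every embedding `τ : F₀ →+* ℚ̄_p` of
the invariant field `F₀` of the base crystalline datum `𝔅 ⊥` there is an integer `a_τ` with every
`τ`-labelled Hodge–Tate weight of the `ℚ̄_p`-linear `ρ|_{Γ_⊥}` in `[a_τ, a_τ + m]` — the common
shape of the range hypotheses of BLGGT Lemma 1.4.3 (2) (`m = p − 2`) and of Gao–Liu's Main
Theorem (`m = p − 1`). [cite: GaoLiu2014, Thm. 3.0.3] -/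
def HasLabelledHodgeTateWeightsInRange (𝔅 : CrystallineExtensionData.{u, w} p K)
    (ρ : FramedGaloisRep K (PadicAlgCl p) n) (m : ℕ) : Prop :=
  ∀ τ : (𝔅 ⊥ inferInstance).F₀ →+* PadicAlgCl p, ∃ a : ℤ,
    ∀ h ∈ (𝔅 ⊥ inferInstance).toPeriodRingData.labelledHodgeTateWeights
        (ρ.restrictField (⊥ : IntermediateField K (AlgebraicClosure K))).toGaloisRep τ,
      a ≤ h ∧ h ≤ a + m

/-- Unfolding lemma. [folklore] -/
theorem hasLabelledHodgeTateWeightsInRange_iff (𝔅 : CrystallineExtensionData.{u, w} p K)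
    (ρ : FramedGaloisRep K (PadicAlgCl p) n) (m : ℕ) :
    HasLabelledHodgeTateWeightsInRange 𝔅 ρ m ↔
      ∀ τ : (𝔅 ⊥ inferInstance).F₀ →+* PadicAlgCl p, ∃ a : ℤ,
        ∀ h ∈ (𝔅 ⊥ inferInstance).toPeriodRingData.labelledHodgeTateWeights
            (ρ.restrictField (⊥ : IntermediateField K (AlgebraicClosure K))).toGaloisRep τ,
          a ≤ h ∧ h ≤ a + m :=
  Iff.rfl

/-- The range hypothesis is monotone in the length of the interval. [folklore] -/
theorem HasLabelledHodgeTateWeightsInRange.mono {𝔅 : CrystallineExtensionData.{u, w} p K}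
    {ρ : FramedGaloisRep K (PadicAlgCl p) n} {m m' : ℕ}
    (h : HasLabelledHodgeTateWeightsInRange 𝔅 ρ m) (hle : m ≤ m') :
    HasLabelledHodgeTateWeightsInRange 𝔅 ρ m' := fun τ => by
  obtain ⟨a, ha⟩ := h τ
  refine ⟨a, fun x hx => ⟨(ha x hx).1, (ha x hx).2.trans ?_⟩⟩
  have hle' : (m : ℤ) ≤ (m' : ℤ) := by exact_mod_cast hle
  omega

/-- The Fontaine–Laffaille range of `blggt2014_lemma_1_4_3_2` is the case `m = p − 2`
(definitionally). [cite: BarnetlambEtAl2014, §1.4 Lemma 1.4.3 (2)] -/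
theorem hasLabelledHodgeTateWeightsInFLRange_iff_inRange (𝔅 : CrystallineExtensionData.{u, w} p K)
    (ρ : FramedGaloisRep K (PadicAlgCl p) n) :
    HasLabelledHodgeTateWeightsInFLRange 𝔅 ρ ↔ HasLabelledHodgeTateWeightsInRange 𝔅 ρ (p - 2) :=
  Iff.rfl

end Range

/-! ### The named fact -/

/-- **Gao–Liu 2014, Main Theorem (Thm. 3.0.3)** — "Suppose `ρ : G_{K₀} → GL_d(ℚ̄_p)` is a
crystalline representation [`K₀/ℚ_p` finite unramified], and for each `τ : K₀ ↪ ℚ̄_p`, the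
Hodge–Tate numbers `HT_τ(ρ) ⊆ {a_τ, …, a_τ + p − 1}`, then `ρ` is potentially diagonalizable"
(potential diagonalizability in the sense of BLGGT §1.4; any prime `p`, any rank `d`, no
hypothesis on the reduction).  Tree rendering, verbatim that of the accepted
`blggt2014_lemma_1_4_3_2` with the interval length `p − 2` replaced by `p − 1`: `K/ℚ_p` finite and
unramified (`IsAbsolutelyUnramified`), `ρ` crystalline over `K` relative to crystalline extension
data `𝔅` (`IsCrystallineFn (𝔅 ⊥) (ρ|_{Γ_⊥}).matrixFn`), labelled Hodge–Tate weights in an interval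
of length `p − 1` at every label (`HasLabelledHodgeTateWeightsInRange 𝔅 ρ (p − 1)`; the condition is
insensitive to the sign convention for `HT_τ`, Gao–Liu's being `HT_τ(ε) = {1}`) ⟹
`IsPotentiallyDiagonalizable 𝔅 ρ`.  Named fact (D-0014), not proved here (printed proof:
Fontaine–Laffaille theory for nilpotent objects in the range `[0, p − 1]`, BLGGT Lemma 1.4.2 and
Lemma 1.4.3 (1), connectedness of `Spec R^{n}_{ρ̄,cris}`). [cite: GaoLiu2014, Thm. 3.0.3] -/
def gaoLiu2014_mainTheorem : Prop :=
  ∀ (p : ℕ) [Fact p.Prime] (K : Type) [Field K] [Algebra ℚ_[p] K] [FiniteDimensional ℚ_[p] K]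
    (𝔅 : CrystallineExtensionData.{0, w} p K) (n : ℕ) (ρ : FramedGaloisRep K (PadicAlgCl p) n),
    IsAbsolutelyUnramified p K →
    IsCrystallineFn (𝔅 ⊥ inferInstance)
      (ρ.restrictField (⊥ : IntermediateField K (AlgebraicClosure K))).matrixFn →
    HasLabelledHodgeTateWeightsInRange 𝔅 ρ (p - 1) →
      IsPotentiallyDiagonalizable 𝔅 ρ

/-- **Gao–Liu's theorem refines BLGGT Lemma 1.4.3 (2)** (as their introduction states): an interval
of length `p − 2` has length `≤ p − 1`. [cite: GaoLiu2014, §1 (Introduction)] -/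
theorem gaoLiu2014_mainTheorem.blggt2014_lemma_1_4_3_2 (h : gaoLiu2014_mainTheorem.{w}) :
    blggt2014_lemma_1_4_3_2.{w} := by
  intro p _ K _ _ _ 𝔅 n ρ hunr hcris hFL
  exact h p K 𝔅 n ρ hunr hcris
    (((hasLabelledHodgeTateWeightsInFLRange_iff_inRange 𝔅 ρ).1 hFL).mono (Nat.sub_le_sub_left (by omega) p))

end Literature.NumberTheory.GaloisRepresentations

end
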